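import Summits.RiemannHypothesis.RiemannHypothesis.Theorems.Splittings.ScrewNullCombUnconditional
import Summits.RiemannHypothesis.RiemannHypothesis.Theorems.Splittings.ScrewNullCombinationFoz

/-!
# Splittings — SCREW NULL COMBINATIONS X: the screw ∃-tail IS bounded negative inertia; `T2 ⟺ R3` exactly

Cell rh-split (brief sha16 f79c5f09d8bcb036), seat rh-split-typer-2 g3 (prover; own initiative «NNC WITHOUT FOZ» on the cross/screw
column, lead GO HOME/INBOX.md 03:41:07Z).  Part X draws the inertia consequences of the unconditional NNC (part IX, `nnc`) inside the
screw-bridge cone (`ScrewBridgeRawG3`, `ScrewBridgeRigidity`, `ScrewNullCombinationFoz`):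
* `nonsingular_or_rigidNull_of_indexBound` / `nonsingular_of_indexBound` — a BOUNDED negative index of the screw Gram matrices
  `S_n` already forces eventual nonsingularity (the index freezes; a null vector at a frozen level is a rigid null combination by
  `ScrewBridgeRigidity.rigid_rows`; `nnc` excludes it) — g4's `foz_nonsingular_or_rigidNull` with FOZ replaced by its only use;
* `etail_iff_boundedIndex` — **ETAIL ⟺ bounded negative index**, unconditionally (`ScrewBridgeRawG3.etail_iff_boundedIndex_and_nonsingular`
  loses its second conjunct): the thresholdless tail of Yoshida's pivot ladder is EXACTLY the statement «`n₋(S_n)` is bounded»;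
* `etail_iff_foz_iff_indexTransfer` — hence target T2 «ETAIL ⟺ FOZ» of `cards/SPLIT-screw-bridge.md` is EQUIVALENT to its last
  residual R3 «IndexTransfer: a bounded negative index forces FOZ» (R1 = `fozIndexBound` landed, R2 discharged): not merely
  «open at R3 only» but literally the same proposition.  [new-combination]

HONEST LABEL: RH-free, FOZ-free linear algebra on top of the kernel theorem `nnc`; it sharpens the CONDITIONAL bridge bookkeeping
of cell rh-split («SPLITTING SEARCH over kernel-typed RH-EQUIVALENCES; a splitting A ∧ B ⟹ RH is CONDITIONAL bookkeeping unless
A and B are both proved») and nothing here bears on the truth of RH.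
-/

set_option linter.dupNamespace false

noncomputable section

namespace Summit.RiemannHypothesis.RiemannHypothesis.Theorems.Splittings.ScrewNullComb

open Finset Matrix
open Literature.NumberTheory.LFunctions
open Summit.RiemannHypothesis.RiemannHypothesis.Theses.RuelleBand
open Summit.RiemannHypothesis.RiemannHypothesis.Theorems.IntegerScrew
open Summit.RiemannHypothesis.RiemannHypothesis.Theorems.IntegerScrew.FozIndexBound
open Summit.RiemannHypothesis.RiemannHypothesis.Theorems.Splittings.ScrewBridgeRawG3
open Summit.RiemannHypothesis.RiemannHypothesis.Theorems.Splittings.ScrewBridgeRigidity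

/-- **Bounded index ⟹ eventually nonsingular OR a rigid null combination** (the proof of g4's
`foz_nonsingular_or_rigidNull` with the index bound — FOZ's only use there — as the hypothesis: the bounded monotone index
freezes, `nat_eventually_const_of_monotone_bounded`, and a null vector at a frozen level kills every later row, `rigid_rows`).
[folklore] -/
theorem nonsingular_or_rigidNull_of_indexBound
    (hK : ∃ K : ℕ, ∀ n : ℕ, (Finset.univ.filter fun i => (screwMatrix_isHermitian n).eigenvalues i < 0).card ≤ K) :
    (∃ N : ℕ, ∀ n : ℕ, N ≤ n → screwDet n ≠ 0) ∨
      ∃ n : ℕ, ∃ z : Fin n → ℝ, z ≠ 0 ∧ ∀ i : ℕ,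
        ∑ j : Fin n, zetaScrewKernel (Real.log ((i + 2 : ℕ) : ℝ))
          (Real.log (((j : ℕ) + 2 : ℕ) : ℝ)) * z j = 0 := by
  obtain ⟨N, k, hNk'⟩ := nat_eventually_const_of_monotone_bounded
    (fun n => (Finset.univ.filter fun i => (screwMatrix_isHermitian n).eigenvalues i < 0).card)
    (fun _ _ hab => negIndex_mono hab) hK
  have hNk : ∀ m : ℕ, N ≤ m → (Finset.univ.filter fun i => (screwMatrix_isHermitian m).eigenvalues i < 0).card = k :=
    fun m hm => hNk' m hm
  by_cases hns : ∃ N' : ℕ, ∀ n : ℕ, N' ≤ n → screwDet n ≠ 0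
  · exact Or.inl hns
  · right
    push Not at hns
    obtain ⟨n, hn, hdet⟩ := hns N
    obtain ⟨z, hz0, hz⟩ := Matrix.exists_mulVec_eq_zero_iff.mpr hdet
    refine ⟨n, z, hz0, fun i => ?_⟩
    have hfrozen : ∀ d : ℕ,
        (univ.filter fun i => (screwMatrix_isHermitian (n + d + 1)).eigenvalues i < 0).card =
          (univ.filter fun i => (screwMatrix_isHermitian (n + d)).eigenvalues i < 0).card :=
      fun d => by rw [hNk (n + d + 1) (by omega), hNk (n + d) (by omega)]
    have := rigid_rows n z hz hfrozen (i + 1) ⟨i, by omega⟩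
    simpa using this

/-- **Bounded index ⟹ the screw matrices are eventually nonsingular**, unconditionally (`nnc` kills the rigid null
combination). [new-combination] -/
theorem nonsingular_of_indexBound
    (hK : ∃ K : ℕ, ∀ n : ℕ, (Finset.univ.filter fun i => (screwMatrix_isHermitian n).eigenvalues i < 0).card ≤ K) :
    ∃ N : ℕ, ∀ n : ℕ, N ≤ n → screwDet n ≠ 0 := by
  rcases nonsingular_or_rigidNull_of_indexBound hK with h | ⟨n, z, hz0, hz⟩
  · exact h
  · exact absurd (nnc n z hz) hz0

/-- **ETAIL ⟺ bounded negative index.**  The screw ∃-tail («the pivots `d_M` are eventually positive») holds iff the negative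
index `n₋(S_n)` of the screw Gram matrices is bounded — `ScrewBridgeRawG3.etail_iff_boundedIndex_and_nonsingular` with its
nonsingularity conjunct discharged by `nonsingular_of_indexBound`.  RH-free, FOZ-free. [new-combination] -/
theorem etail_iff_boundedIndex :
    (∃ M₀ : ℕ, ∀ M : ℕ, M₀ ≤ M → 0 < screwPivot M) ↔
      ∃ K : ℕ, ∀ n : ℕ, (Finset.univ.filter fun i => (screwMatrix_isHermitian n).eigenvalues i < 0).card ≤ K :=
  ⟨fun h => (etail_iff_boundedIndex_and_nonsingular.mp h).1,
    fun hK => etail_iff_boundedIndex_and_nonsingular.mpr ⟨hK, nonsingular_of_indexBound hK⟩⟩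

/-- **Bounded index ⟹ ETAIL** (the usable direction on its own). [new-combination] -/
theorem etail_of_indexBound
    (hK : ∃ K : ℕ, ∀ n : ℕ, (Finset.univ.filter fun i => (screwMatrix_isHermitian n).eigenvalues i < 0).card ≤ K) :
    ∃ M₀ : ℕ, ∀ M : ℕ, M₀ ≤ M → 0 < screwPivot M :=
  etail_iff_boundedIndex.mpr hK

/-- **T2 ⟺ R3, exactly.**  Target T2 «ETAIL ⟺ FOZ» holds iff the residual R3 «IndexTransfer: a bounded negative index forces
FOZ» holds (R1 `fozIndexBound`: FOZ bounds the index; `etail_iff_boundedIndex`). [new-combination] -/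
theorem etail_iff_foz_iff_indexTransfer :
    ((∃ M₀ : ℕ, ∀ M : ℕ, M₀ ≤ M → 0 < screwPivot M) ↔ CofiniteCriticalLine) ↔
      ((∃ K : ℕ, ∀ n : ℕ, (Finset.univ.filter fun i => (screwMatrix_isHermitian n).eigenvalues i < 0).card ≤ K) →
        CofiniteCriticalLine) := by
  rw [etail_iff_boundedIndex]
  exact ⟨fun h hK => h.mp hK, fun hT => ⟨hT, fun hfoz => fozIndexBound hfoz⟩⟩

/-- **ETAIL ⟹ FOZ is exactly IndexTransfer** (the converse half alone). [new-combination] -/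
theorem etail_imp_foz_iff_indexTransfer :
    ((∃ M₀ : ℕ, ∀ M : ℕ, M₀ ≤ M → 0 < screwPivot M) → CofiniteCriticalLine) ↔
      ((∃ K : ℕ, ∀ n : ℕ, (Finset.univ.filter fun i => (screwMatrix_isHermitian n).eigenvalues i < 0).card ≤ K) →
        CofiniteCriticalLine) := by
  rw [etail_iff_boundedIndex]

end Summit.RiemannHypothesis.RiemannHypothesis.Theorems.Splittings.ScrewNullComb

end
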